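import Summits.Schanuel.Schanuel.Theorems.ZilberEacParamFibreCurveComplete
import Summits.Schanuel.Schanuel.Theorems.ZilberEacFibreCurveDensity
import HarnessLib

/-!
# Polynomially parametrised base curves, XXIII: fibre curves `P(t, y₀) = 0` over a polynomial
# curve in plain coordinates, and the examples `{x₀ = y₀², x₁ = y₀³}`, `{x₀ = y₀², x₁ = y₀⁴ + y₀}`

HONEST FRAMING.  Cell `pub-schanuel` (Zilber's Exponential-Algebraic Closedness, case ladder;
host summit Schanuel), seat 2, gen 20.  Bookkeeping around files XXI–XXII: the surface
`{(g₀(t), g₁(t), y₀, y₁) : P(t, y₀) = 0}` for `P ∈ ℂ[t, y₀]` IS `S(g; P̃)` with `P̃` the lift of `P`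
to `ℂ[t, y₀, y₁]` (`paramFibreCurveSurface_eq`), so file XXI gives
**`unprojectedDense_paramFibreCurve`**: `d = deg g₀ ≥ 2`, `n = deg g₁ ≥ 1`, phase condition
`d ∤ n ∨ Re(lc(g₁)(i/lc(g₀))^{n/d}) ≠ 0`, `P` irreducible with two `y₀`-degrees ⟹ Zariski-dense
exponential points; case ∧ dense with nonzero fibre roots over infinitely many `t`.  EXAMPLES:
(1) `P = y₀ - t` over the cusp `(t², t³)`: the surface **`{x₀ = y₀², x₁ = y₀³}`** is in
Mantova–Masser's case and its exponential points `(y², y³, y, e^{y³})`, `e^{y²} = y`, are Zariski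
dense (`2 ∤ 3`: no phase condition); (2) `P = y₀ - t` over `(t², t⁴ + t)` (`2 ∣ 4`, phase
`Re((i)²) = -1 ≠ 0`): **`{x₀ = y₀², x₁ = y₀⁴ + y₀}`** case ∧ dense.  NOT covered (vanishing phase):
`(t², i t⁴)` with `P ∈ ℂ[t, y₀]`.  Instances of Mantova–Masser's OPEN question (PLMS 2024 §1
p. 5); NOT Schanuel's conjecture (neither used nor implied; EAC ⇏ SC); `EC(3,2)` stays OPEN.
-/

noncomputable section

open Filter Topology Set Complex MvPolynomial
open Literature.NumberTheory.Transcendental Literature.ModelTheory.Zilber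
open Literature.ModelTheory.ExponentialFields

set_option linter.dupNamespace false

namespace Summit.Schanuel.Schanuel.Theorems

/-! ## Part A. Fibre curves `P(t, y₀) = 0`, `P ∈ ℂ[t, y₀]`, in plain coordinates -/

section Lift

variable (g₀ g₁ : Polynomial ℂ) (P : MvPolynomial (Fin 2) ℂ)

/-- Evaluating the lift `P̃ ∈ ℂ[t, y₀, y₁]` at `(t, y₀, y₁)` given by `Fin.cases`. -/
theorem eval_cases_rename_castSucc (t : ℂ) (y : Fin 2 → ℂ) :
    MvPolynomial.eval (Fin.cases t y : Fin 3 → ℂ) (rename (Fin.castSucc : Fin 2 → Fin 3) P) =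
      MvPolynomial.eval ![t, y 0] P := by
  rw [eval_rename]
  have e : ((Fin.cases t y : Fin 3 → ℂ) ∘ (Fin.castSucc : Fin 2 → Fin 3)) = ![t, y 0] := by
    funext i
    fin_cases i <;> rfl
  rw [e]

/-- `{(g₀(t), g₁(t), y₀, y₁) : P(t, y₀) = 0} = S(g; P̃)`. -/
theorem paramFibreCurveSurface_eq :
    {w : Fin 2 ⊕ Fin 2 → ℂ | ∃ t : ℂ, w (Sum.inl 0) = g₀.eval t ∧ w (Sum.inl 1) = g₁.eval t ∧
      MvPolynomial.eval ![t, w (Sum.inr 0)] P = 0} =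
    {w : Fin 2 ⊕ Fin 2 → ℂ | ∃ t : ℂ, w (Sum.inl 0) = g₀.eval t ∧ w (Sum.inl 1) = g₁.eval t ∧
      MvPolynomial.eval (Fin.cases t (fun i => w (Sum.inr i)) : Fin 3 → ℂ)
        (rename (Fin.castSucc : Fin 2 → Fin 3) P) = 0} := by
  ext w
  simp only [Set.mem_setOf_eq, eval_cases_rename_castSucc]

/-- The lift `P̃` does not involve `y₁`. -/
theorem support_rename_castSucc_y1 :
    ∀ m ∈ (rename (Fin.castSucc : Fin 2 → Fin 3) P).support, m 2 = 0 := by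
  classical
  intro m hm
  rw [support_rename_of_injective (Fin.castSucc_injective 2)] at hm
  obtain ⟨v, -, rfl⟩ := Finset.mem_image.1 hm
  exact Finsupp.mapDomain_notin_range _ _ (by
    rintro ⟨i, hi⟩
    have := congrArg Fin.val hi
    fin_cases i <;> simp at this)

variable {P}

/-- Two `y₀`-degrees of `P` give two `y₀`-degrees of `P̃`. -/
theorem exists_support_rename_castSucc_y0 (h1 : ∃ v ∈ P.support, ∃ v' ∈ P.support, v 1 ≠ v' 1) :
    ∃ m ∈ (rename (Fin.castSucc : Fin 2 → Fin 3) P).support,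
      ∃ m' ∈ (rename (Fin.castSucc : Fin 2 → Fin 3) P).support, m 1 ≠ m' 1 := by
  classical
  obtain ⟨v, hv, v', hv', hne⟩ := h1
  have hinj := Fin.castSucc_injective 2
  refine ⟨Finsupp.mapDomain Fin.castSucc v, ?_, Finsupp.mapDomain Fin.castSucc v', ?_, ?_⟩
  · rw [support_rename_of_injective hinj]; exact Finset.mem_image_of_mem _ hv
  · rw [support_rename_of_injective hinj]; exact Finset.mem_image_of_mem _ hv'
  · have e1 : Finsupp.mapDomain Fin.castSucc v (1 : Fin 3) = v 1 :=
      Finsupp.mapDomain_apply hinj v (1 : Fin 2)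
    have e1' : Finsupp.mapDomain Fin.castSucc v' (1 : Fin 3) = v' 1 :=
      Finsupp.mapDomain_apply hinj v' (1 : Fin 2)
    rw [e1, e1']
    exact hne

variable {g₀ g₁}

/-- **Zariski density for fibre curves `P(t, y₀) = 0` over a polynomial curve.**  `d = deg g₀ ≥ 2`,
`n = deg g₁ ≥ 1`, phase condition `d ∤ n ∨ Re(lc(g₁)(i/lc(g₀))^{n/d}) ≠ 0`, `P ∈ ℂ[t, y₀]`
irreducible with two monomials of different `y₀`-degree ⟹ the exponential points of
`{(g₀(t), g₁(t), y₀, y₁) : P(t, y₀) = 0} ⊆ ℂ² × ℂ²` are Zariski dense.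
[cite: MantovaMasser2023, §1 Further remarks, p. 5 (the question, open in general)] (new) -/
theorem unprojectedDense_paramFibreCurve (hd : 2 ≤ g₀.natDegree) (hn : 1 ≤ g₁.natDegree)
    (hph : ¬ g₀.natDegree ∣ g₁.natDegree ∨
      (g₁.leadingCoeff * (I / g₀.leadingCoeff) ^ (g₁.natDegree / g₀.natDegree)).re ≠ 0)
    (hirr : Irreducible P) (h1 : ∃ v ∈ P.support, ∃ v' ∈ P.support, v 1 ≠ v' 1) :
    UnprojectedDense {w : Fin 2 ⊕ Fin 2 → ℂ | ∃ t : ℂ, w (Sum.inl 0) = g₀.eval t ∧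
      w (Sum.inl 1) = g₁.eval t ∧ MvPolynomial.eval ![t, w (Sum.inr 0)] P = 0} := by
  rw [paramFibreCurveSurface_eq]
  exact unprojectedDense_paramSurface₃_of_y0 g₀ g₁ hd hn hph (irreducible_rename_castSucc₂ hirr)
    (support_rename_castSucc_y1 P) (exists_support_rename_castSucc_y0 h1)

/-- **Mantova–Masser's question for fibre curves over a polynomial curve: case ∧ dense** (plain
coordinates; nonzero fibre roots over infinitely many `t` in addition).
[cite: MantovaMasser2023, §1 Further remarks, p. 5 (the question, open in general)] (new) -/
theorem unprojectedDensityQuestion_instance_paramFibreCurve (hd : 2 ≤ g₀.natDegree)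
    (hn : 1 ≤ g₁.natDegree)
    (hph : ¬ g₀.natDegree ∣ g₁.natDegree ∨
      (g₁.leadingCoeff * (I / g₀.leadingCoeff) ^ (g₁.natDegree / g₀.natDegree)).re ≠ 0)
    (hirr : Irreducible P) (h1 : ∃ v ∈ P.support, ∃ v' ∈ P.support, v 1 ≠ v' 1)
    (hfib : Set.Infinite {t : ℂ | ∃ y : ℂ, y ≠ 0 ∧ MvPolynomial.eval ![t, y] P = 0}) :
    MMCaseDimPiOneFree {w : Fin 2 ⊕ Fin 2 → ℂ | ∃ t : ℂ, w (Sum.inl 0) = g₀.eval t ∧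
        w (Sum.inl 1) = g₁.eval t ∧ MvPolynomial.eval ![t, w (Sum.inr 0)] P = 0} ∧
      UnprojectedDense {w : Fin 2 ⊕ Fin 2 → ℂ | ∃ t : ℂ, w (Sum.inl 0) = g₀.eval t ∧
        w (Sum.inl 1) = g₁.eval t ∧ MvPolynomial.eval ![t, w (Sum.inr 0)] P = 0} := by
  rw [paramFibreCurveSurface_eq]
  refine unprojectedDensityQuestion_instance_paramSurface₃_of_y0 g₀ g₁ hd hn hph
    (irreducible_rename_castSucc₂ hirr) (support_rename_castSucc_y1 P)
    (exists_support_rename_castSucc_y0 h1) (hfib.mono ?_)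
  rintro t ⟨y, hy, hty⟩
  exact ⟨y, hy, by rw [eval_vec3_rename_castSucc]; exact hty⟩

end Lift

/-! ## Part B. Examples: `P = y₀ - t` over the cusp `(t², t³)` and over `(t², t⁴ + t)` -/

section Examples

/-- `y₀ - t = X₂¹ - X₁` is a cyclic-cover polynomial of exponent `1`. -/
theorem X1_sub_X0_eq_cyclicCoverPoly :
    (X 1 - X 0 : MvPolynomial (Fin 2) ℂ) = cyclicCoverPoly 1 (X 0 : MvPolynomial (Fin 1) ℂ) := by
  rw [cyclicCoverPoly, pow_one, rename_X]
  rfl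

/-- `y₀ - t` is irreducible. -/
theorem irreducible_X1_sub_X0 : Irreducible (X 1 - X 0 : MvPolynomial (Fin 2) ℂ) := by
  rw [X1_sub_X0_eq_cyclicCoverPoly]
  exact irreducible_cyclicCoverPoly_of_irreducible one_pos
    (MvPolynomial.X_prime (R := ℂ) (σ := Fin 1) (i := 0)).irreducible

/-- `y₀ - t` has the monomials `y₀` and `t`, of different `y₀`-degree. -/
theorem X1_sub_X0_support_pair :
    ∃ v ∈ (X 1 - X 0 : MvPolynomial (Fin 2) ℂ).support,
      ∃ v' ∈ (X 1 - X 0 : MvPolynomial (Fin 2) ℂ).support, v 1 ≠ v' 1 := by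
  classical
  have hne : (Finsupp.single (1 : Fin 2) 1 : Fin 2 →₀ ℕ) ≠ Finsupp.single 0 1 := by
    intro h; have := DFunLike.congr_fun h 1; simp at this
  refine ⟨Finsupp.single 1 1, ?_, Finsupp.single 0 1, ?_, ?_⟩
  · rw [MvPolynomial.mem_support_iff, MvPolynomial.coeff_sub, MvPolynomial.coeff_X,
      MvPolynomial.coeff_X, if_pos rfl, if_neg hne.symm]
    norm_num
  · rw [MvPolynomial.mem_support_iff, MvPolynomial.coeff_sub, MvPolynomial.coeff_X,
      MvPolynomial.coeff_X, if_neg hne, if_pos rfl]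
    norm_num
  · simp

/-- Nonzero fibre roots of `y₀ = t` over every `t ≠ 0`. -/
theorem X1_sub_X0_fibres_infinite :
    Set.Infinite {t : ℂ | ∃ y : ℂ, y ≠ 0 ∧
      MvPolynomial.eval ![t, y] (X 1 - X 0 : MvPolynomial (Fin 2) ℂ) = 0} := by
  refine ((Set.finite_singleton (0 : ℂ)).infinite_compl).mono ?_
  intro t ht
  exact ⟨t, ht, by simp⟩

/-- **Example 1 (the cusp, `2 ∤ 3`).**  The surface `{(t², t³, y₀, y₁) : y₀ = t}`, i.e.
`{x₀ = y₀², x₁ = y₀³} ⊆ ℂ² × ℂ²`, is in Mantova–Masser's case and its exponential points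
`(y², y³, y, e^{y³})` with `e^{y²} = y` are Zariski dense. (new) -/
theorem unprojectedDensityQuestion_instance_cusp_y0_eq_t :
    MMCaseDimPiOneFree {w : Fin 2 ⊕ Fin 2 → ℂ | ∃ t : ℂ,
        w (Sum.inl 0) = (Polynomial.X ^ 2 : Polynomial ℂ).eval t ∧
        w (Sum.inl 1) = (Polynomial.X ^ 3 : Polynomial ℂ).eval t ∧
        MvPolynomial.eval ![t, w (Sum.inr 0)] (X 1 - X 0 : MvPolynomial (Fin 2) ℂ) = 0} ∧
      UnprojectedDense {w : Fin 2 ⊕ Fin 2 → ℂ | ∃ t : ℂ,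
        w (Sum.inl 0) = (Polynomial.X ^ 2 : Polynomial ℂ).eval t ∧
        w (Sum.inl 1) = (Polynomial.X ^ 3 : Polynomial ℂ).eval t ∧
        MvPolynomial.eval ![t, w (Sum.inr 0)] (X 1 - X 0 : MvPolynomial (Fin 2) ℂ) = 0} := by
  refine unprojectedDensityQuestion_instance_paramFibreCurve (by simp) (by simp) (Or.inl ?_)
    irreducible_X1_sub_X0 X1_sub_X0_support_pair X1_sub_X0_fibres_infinite
  simp only [Polynomial.natDegree_pow, Polynomial.natDegree_X]
  norm_num

/-- The same surface in plain coordinates: `{x₀ = y₀², x₁ = y₀³}` has Zariski-dense exponential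
points. (new) -/
theorem unprojectedDense_x0_eq_y0sq_x1_eq_y0cube :
    UnprojectedDense {w : Fin 2 ⊕ Fin 2 → ℂ |
      w (Sum.inl 0) = w (Sum.inr 0) ^ 2 ∧ w (Sum.inl 1) = w (Sum.inr 0) ^ 3} := by
  have h := unprojectedDensityQuestion_instance_cusp_y0_eq_t.2
  have hset : {w : Fin 2 ⊕ Fin 2 → ℂ | ∃ t : ℂ,
        w (Sum.inl 0) = (Polynomial.X ^ 2 : Polynomial ℂ).eval t ∧
        w (Sum.inl 1) = (Polynomial.X ^ 3 : Polynomial ℂ).eval t ∧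
        MvPolynomial.eval ![t, w (Sum.inr 0)] (X 1 - X 0 : MvPolynomial (Fin 2) ℂ) = 0} =
      {w : Fin 2 ⊕ Fin 2 → ℂ |
        w (Sum.inl 0) = w (Sum.inr 0) ^ 2 ∧ w (Sum.inl 1) = w (Sum.inr 0) ^ 3} := by
    ext w
    simp only [Set.mem_setOf_eq, Polynomial.eval_pow, Polynomial.eval_X, map_sub,
      MvPolynomial.eval_X, Matrix.cons_val_one, Matrix.cons_val_zero, Matrix.cons_val_fin_one,
      sub_eq_zero]
    constructor
    · rintro ⟨t, h0, h1, rfl⟩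
      exact ⟨h0, h1⟩
    · rintro ⟨h0, h1⟩
      exact ⟨w (Sum.inr 0), h0, h1, rfl⟩
  rw [← hset]
  exact h

/-- `deg (X⁴ + X) = 4`. -/
theorem natDegree_X_pow_four_add_X :
    (Polynomial.X ^ 4 + Polynomial.X : Polynomial ℂ).natDegree = 4 := by
  rw [Polynomial.natDegree_add_eq_left_of_natDegree_lt] <;> simp

/-- `lc (X⁴ + X) = 1`. -/
theorem leadingCoeff_X_pow_four_add_X :
    (Polynomial.X ^ 4 + Polynomial.X : Polynomial ℂ).leadingCoeff = 1 := by
  rw [Polynomial.leadingCoeff, natDegree_X_pow_four_add_X]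
  simp [Polynomial.coeff_X]

/-- **Example 2 (`2 ∣ 4`, non-vanishing phase `Re(i²) = -1`).**  The surface
`{(t², t⁴ + t, y₀, y₁) : y₀ = t}`, i.e. `{x₀ = y₀², x₁ = y₀⁴ + y₀}`, is in Mantova–Masser's case and
its exponential points (`e^{y²} = y`) are Zariski dense. (new) -/
theorem unprojectedDensityQuestion_instance_quartic_y0_eq_t :
    MMCaseDimPiOneFree {w : Fin 2 ⊕ Fin 2 → ℂ | ∃ t : ℂ,
        w (Sum.inl 0) = (Polynomial.X ^ 2 : Polynomial ℂ).eval t ∧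
        w (Sum.inl 1) = (Polynomial.X ^ 4 + Polynomial.X : Polynomial ℂ).eval t ∧
        MvPolynomial.eval ![t, w (Sum.inr 0)] (X 1 - X 0 : MvPolynomial (Fin 2) ℂ) = 0} ∧
      UnprojectedDense {w : Fin 2 ⊕ Fin 2 → ℂ | ∃ t : ℂ,
        w (Sum.inl 0) = (Polynomial.X ^ 2 : Polynomial ℂ).eval t ∧
        w (Sum.inl 1) = (Polynomial.X ^ 4 + Polynomial.X : Polynomial ℂ).eval t ∧
        MvPolynomial.eval ![t, w (Sum.inr 0)] (X 1 - X 0 : MvPolynomial (Fin 2) ℂ) = 0} := by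
  refine unprojectedDensityQuestion_instance_paramFibreCurve (by simp)
    (by rw [natDegree_X_pow_four_add_X]; norm_num) (Or.inr ?_)
    irreducible_X1_sub_X0 X1_sub_X0_support_pair X1_sub_X0_fibres_infinite
  rw [natDegree_X_pow_four_add_X, leadingCoeff_X_pow_four_add_X]
  simp only [Polynomial.natDegree_pow, Polynomial.natDegree_X, Polynomial.leadingCoeff_X_pow,
    mul_one, div_one, one_mul]
  norm_num [Complex.I_sq]

end Examples

/-! ## Part C. On the rung: threefolds fibred in curves over these surfaces meet `Γ_exp` -/

/-- **New members of `EC(3,2)` (fibre curves over polynomial curves).**  An irreducible threefold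
`W ⊆ ℂ³ × ℂ³` of dimension `3` meeting the torus, with `dim cl[Δ₂](W ∩ G³) = 2`, whose projected
surface `cl pr(W ∩ G³)` is `{(g₀(t), g₁(t), y₀, y₁) : P(t, y₀) = 0}` (`deg g₀ ≥ 2`, `deg g₁ ≥ 1`,
phase condition, `P` irreducible with two `y₀`-degrees), meets the graph of exponentiation
(THEOREM F′; no rotundity or freeness hypothesis). [cite: MantovaMasser2023, §1 Further remarks,
p. 5] (new) -/
theorem inter_expGraph_nonempty_of_fibred_over_paramFibreCurve (g₀ g₁ : Polynomial ℂ)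
    (hd : 2 ≤ g₀.natDegree) (hn : 1 ≤ g₁.natDegree)
    (hph : ¬ g₀.natDegree ∣ g₁.natDegree ∨
      (g₁.leadingCoeff * (I / g₀.leadingCoeff) ^ (g₁.natDegree / g₀.natDegree)).re ≠ 0)
    {P : MvPolynomial (Fin 2) ℂ} (hirr : Irreducible P)
    (h1 : ∃ v ∈ P.support, ∃ v' ∈ P.support, v 1 ≠ v' 1)
    {W : Set (Fin (2 + 1) ⊕ Fin (2 + 1) → ℂ)}
    (hW : IsIrreducibleClosed ℂ W) (hne : (W ∩ torusLocus ℂ (2 + 1)).Nonempty)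
    (hdim : zariskiDim ℂ W = (2 + 1 : ℕ))
    (hfib : zariskiDim ℂ (matrixAct (dropLastMat 2) '' (W ∩ torusLocus ℂ (2 + 1))) = (2 : ℕ))
    (hV : zeroLocus ℂ (vanishingIdeal ℂ
      ((fun (w : Fin (2 + 1) ⊕ Fin (2 + 1) → ℂ) (t : Fin 2 ⊕ Fin 2) =>
        w (Sum.map Fin.castSucc Fin.castSucc t)) '' (W ∩ torusLocus ℂ (2 + 1)))) =
      {w : Fin 2 ⊕ Fin 2 → ℂ | ∃ t : ℂ, w (Sum.inl 0) = g₀.eval t ∧ w (Sum.inl 1) = g₁.eval t ∧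
        MvPolynomial.eval ![t, w (Sum.inr 0)] P = 0}) :
    (W ∩ expGraph ℂ (2 + 1)).Nonempty :=
  inter_expGraph_nonempty_of_unprojectedDense_proj hW hne hdim hfib
    (by rw [hV]; exact unprojectedDense_paramFibreCurve hd hn hph hirr h1)

end Summit.Schanuel.Schanuel.Theorems
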